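/-
Copyright (c) 2026 the pub-hodgecm-mathlib formalisation cell (harness21).  Prover seat hodgecm-mathlib-K2E1-p08 (g5), Track B ∕ K2-LIT, h413 =
`stmt-HodgeConjecture-24833`, campaign «EIS-RANK-ONE» [D5] `K2E1KFiniteArchSmoothU2`, Fréchet road, file (D5-a1): the one-variable symbol estimate behind the archimedean
smoothness of the spherical flat section along the big-cell line of `U(1,1)` (dealer K2E1-plan (g4) 2026-09-04T06:23:41Z, my cut 06:24:54Z).
-/
import Mathlib
import HarnessLib

/-!
# K2·E1 — `K2E1OnePlusSqPowerSymbol` ([D5] file (D5-a1)): THE SYMBOL ESTIMATE `‖Dⁿ (1 + c s²)^{−z}‖ ≤ Cₙ · (1 + c s²)^{−Re z}` ON `ℝ`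

Track B ∕ K2-LIT, crux h413 = `stmt-HodgeConjecture-24833`, route of record `HCCMUnconditional`; cell `hodgecm-mathlib`, squad K2, ENGINE E1, campaign EIS-RANK-ONE, deal [D5]
(archimedean smoothness of flat sections along the big-cell line of `U(J₂)`, the `hφarch` binder of ★ `K2E1EisensteinMinusConstantTermBoundedArchCMTwo`).  Prover seat
`hodgecm-mathlib-K2E1-p08` (g5).  THEOREMS ONLY (no `def`, no `instance`, no notation, no named-fact hypothesis, no `sorry`); lane `--kind proof --supports
stmt-HodgeConjecture-24833 --as helper` (count-neutral, closes no socket).  Pure one-variable calculus (a librarian may re-home it under `Literature/Analysis/Calculus`).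

WHY.  Along the big-cell line of `U(1,1)` the Borel height of the spherical section is, place by place at infinity, `s ↦ (1 + c s²)^{−κ}` (`c = |δ_w|² > 0`), and the flat section
`H^z` is the tensor product of the functions `F(s) = (1 + c s²)^{−z}` (complex exponent, `Re z > 1`).  The archimedean binder `hφarch` asks for `C^m` smoothness with ALL derivatives
dominated by the envelope `H^{Re z}` itself — i.e. that `F` is a SYMBOL of order `0` relative to its own modulus:
* §1 `F` and its modulus: `F(s) = exp(−z·log(1 + c s²))` equals the principal power `((1 + c s²) : ℂ)^{−z}` and `‖F(s)‖ = (1 + c s²)^{−Re z}`; `F` is `C^∞`.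
* §2 THE STRUCTURE OF THE DERIVATIVES (induction): `F⁽ⁿ⁾(s) = F(s) · Pₙ(s) · (1 + c s²)^{−n}` with `Pₙ ∈ ℂ[X]`, `deg Pₙ ≤ n`
  (`P₀ = 1`, `Pₙ₊₁ = −2c(z + n)·X·Pₙ + (1 + cX²)·Pₙ'`).
* §3 THE SYMBOL ESTIMATE **`exists_norm_iteratedDeriv_le`**: `∀ n, ∃ C ≥ 0, ∀ s, ‖F⁽ⁿ⁾(s)‖ ≤ C · (1 + c s²)^{−Re z}` (`|s|^i ≤ (1+s²)^i ≤ Kⁱ(1+cs²)^i`, `K = max 1 c⁻¹`, `i ≤ n`),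
  and the `ContDiff` statement `contDiff_onePlusSqPow`.
[MoeglinWaldspurger1995, I.2.10–I.2.12 (derivatives of sections are dominated by the height); Garrett2018, §12.2 (archimedean integration by parts); Hörmander, ALPDO I, §7.1 (symbols).]

HONEST LABEL: HC_CM is proved only modulo the 7 printed citations (2 remaining named inputs: hLiu418 = `stmt-HodgeConjecture-24832`, h413 = `stmt-HodgeConjecture-24833`) until
rung 0 closes; count-neutral helper, closes no socket.

## References
* [MoeglinWaldspurger1995] C. Mœglin, J.-L. Waldspurger, *Spectral Decomposition and Eisenstein Series* (1995), I.2.10–I.2.12.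
* [Garrett2018] P. Garrett, *Modern Analysis of Automorphic Forms by Example* (2018), §12.2.
* [HormanderALPDO1] L. Hörmander, *The Analysis of Linear Partial Differential Operators I* (1983), §7.1.
-/

set_option autoImplicit false
-- the mandated namespace repeats the single-problem summit's segment (`HodgeConjecture.HodgeConjecture`)
set_option linter.dupNamespace false

noncomputable section

open Real Complex Polynomial
open scoped ContDiff

namespace Summit.HodgeConjecture.HodgeConjecture.Cruxes.H413.K2E1OnePlusSqPowerSymbol

/-! ## §1 The function `F(s) = exp(−z·log(1 + c s²)) = (1 + c s²)^{−z}`, its modulus and its smoothness -/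

/-- `1 + c s² > 0` for `c ≥ 0`. [folklore] -/
theorem onePlusSq_pos {c : ℝ} (hc : 0 ≤ c) (s : ℝ) : 0 < 1 + c * s ^ 2 := by positivity

/-- `1 ≤ 1 + c s²` for `c ≥ 0`. [folklore] -/
theorem one_le_onePlusSq {c : ℝ} (hc : 0 ≤ c) (s : ℝ) : 1 ≤ 1 + c * s ^ 2 := le_add_of_nonneg_right (by positivity)

/-- **The exponential form IS the principal power**: `exp(−z·log(1 + c s²)) = ((1 + c s²) : ℂ)^{−z}` (positive real base). [folklore] -/
theorem exp_neg_mul_log_eq_cpow {c : ℝ} (hc : 0 ≤ c) (z : ℂ) (s : ℝ) :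
    Complex.exp (-z * (Real.log (1 + c * s ^ 2) : ℂ)) = (((1 + c * s ^ 2 : ℝ)) : ℂ) ^ (-z) := by
  have hpos := onePlusSq_pos hc s
  rw [Complex.cpow_def_of_ne_zero (by exact_mod_cast hpos.ne'), ← Complex.ofReal_log hpos.le, mul_comm]

/-- **The modulus**: `‖exp(−z·log(1 + c s²))‖ = (1 + c s²)^{−Re z}`. [folklore] -/
theorem norm_exp_neg_mul_log {c : ℝ} (hc : 0 ≤ c) (z : ℂ) (s : ℝ) :
    ‖Complex.exp (-z * (Real.log (1 + c * s ^ 2) : ℂ))‖ = (1 + c * s ^ 2) ^ (-z.re) := by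
  rw [Complex.norm_exp, Real.rpow_def_of_pos (onePlusSq_pos hc s)]
  congr 1
  simp [Complex.mul_re, Complex.ofReal_re, Complex.ofReal_im, mul_comm]

/-- **`F` is `C^∞`** (`log` is smooth on `(0, ∞)`, `exp` entire). [folklore] -/
theorem contDiff_exp_neg_mul_log {c : ℝ} (hc : 0 ≤ c) (z : ℂ) {n : WithTop ℕ∞} :
    ContDiff ℝ n (fun s : ℝ => Complex.exp (-z * (Real.log (1 + c * s ^ 2) : ℂ))) := by
  have hq : ContDiff ℝ n (fun s : ℝ => 1 + c * s ^ 2) := contDiff_const.add (contDiff_const.mul (contDiff_id.pow 2))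
  have hlog : ContDiff ℝ n (fun s : ℝ => Real.log (1 + c * s ^ 2)) := hq.log fun s => (onePlusSq_pos hc s).ne'
  have hof : ContDiff ℝ n (fun s : ℝ => ((Real.log (1 + c * s ^ 2) : ℝ) : ℂ)) := Complex.ofRealCLM.contDiff.comp hlog
  exact (Complex.contDiff_exp (𝕜 := ℝ)).comp (contDiff_const.mul hof)

/-- **`(1 + c s²)^{−z}` is `C^∞` on `ℝ`** (principal power of a positive real base, complex exponent). [folklore] -/
theorem contDiff_onePlusSqPow {c : ℝ} (hc : 0 ≤ c) (z : ℂ) {n : WithTop ℕ∞} :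
    ContDiff ℝ n (fun s : ℝ => ((((1 + c * s ^ 2 : ℝ)) : ℂ) ^ (-z))) := by
  have hfun : (fun s : ℝ => ((((1 + c * s ^ 2 : ℝ)) : ℂ) ^ (-z))) = fun s : ℝ => Complex.exp (-z * (Real.log (1 + c * s ^ 2) : ℂ)) :=
    funext fun s => (exp_neg_mul_log_eq_cpow hc z s).symm
  rw [hfun]
  exact contDiff_exp_neg_mul_log hc z

/-! ## §2 The structure of the derivatives: `F⁽ⁿ⁾ = F · Pₙ · (1 + c s²)^{−n}`, `deg Pₙ ≤ n` -/

/-- The derivative of `F(s) = exp(−z·log(1 + cs²))`: `F'(s) = F(s) · (−z · 2cs · (1 + cs²)⁻¹)`. [folklore] -/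
theorem hasDerivAt_exp_neg_mul_log {c : ℝ} (hc : 0 ≤ c) (z : ℂ) (s : ℝ) :
    HasDerivAt (fun s : ℝ => Complex.exp (-z * (Real.log (1 + c * s ^ 2) : ℂ)))
      (Complex.exp (-z * (Real.log (1 + c * s ^ 2) : ℂ)) * (-z * (((2 * c * s : ℝ) : ℂ) * ((((1 + c * s ^ 2 : ℝ)) : ℂ))⁻¹))) s := by
  have hq : HasDerivAt (fun s : ℝ => 1 + c * s ^ 2) (2 * c * s) s := by
    have h := ((hasDerivAt_pow 2 s).const_mul c).const_add 1
    simpa [mul_comm, mul_assoc, mul_left_comm] using h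
  have hlog : HasDerivAt (fun s : ℝ => Real.log (1 + c * s ^ 2)) ((2 * c * s) / (1 + c * s ^ 2)) s := by
    have h := hq.log (onePlusSq_pos hc s).ne'
    simpa [div_eq_mul_inv, mul_comm] using h
  have hof : HasDerivAt (fun s : ℝ => ((Real.log (1 + c * s ^ 2) : ℝ) : ℂ)) ((((2 * c * s) / (1 + c * s ^ 2) : ℝ)) : ℂ) s :=
    hlog.ofReal_comp
  have hin : HasDerivAt (fun s : ℝ => -z * ((Real.log (1 + c * s ^ 2) : ℝ) : ℂ)) (-z * ((((2 * c * s) / (1 + c * s ^ 2) : ℝ)) : ℂ)) s :=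
    hof.const_mul (-z)
  have hexp := hin.cexp
  convert hexp using 1
  push_cast
  ring

/-- The derivative of `s ↦ P(s)` for a complex polynomial along the real line: `P'(s)`. [folklore] -/
theorem hasDerivAt_polynomial_eval_ofReal (P : ℂ[X]) (s : ℝ) :
    HasDerivAt (fun s : ℝ => P.eval (s : ℂ)) (P.derivative.eval (s : ℂ)) s := by
  exact (P.hasDerivAt (s : ℂ)).comp_ofReal

/-- The derivative of `s ↦ ((1 + cs²) : ℂ)⁻¹ ^ n`: `−n · 2cs · ((1+cs²) : ℂ)⁻¹ ^ (n+1)`. [folklore] -/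
theorem hasDerivAt_inv_onePlusSq_pow {c : ℝ} (hc : 0 ≤ c) (n : ℕ) (s : ℝ) :
    HasDerivAt (fun s : ℝ => (((((1 + c * s ^ 2 : ℝ)) : ℂ))⁻¹) ^ n)
      (-(n : ℂ) * (((2 * c * s : ℝ) : ℂ)) * (((((1 + c * s ^ 2 : ℝ)) : ℂ))⁻¹) ^ (n + 1)) s := by
  have hq0 : ((((1 + c * s ^ 2 : ℝ)) : ℂ)) ≠ 0 := by exact_mod_cast (onePlusSq_pos hc s).ne'
  have hq : HasDerivAt (fun s : ℝ => ((((1 + c * s ^ 2 : ℝ)) : ℂ))) (((2 * c * s : ℝ) : ℂ)) s := by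
    have h : HasDerivAt (fun s : ℝ => 1 + c * s ^ 2) (2 * c * s) s := by
      have h := ((hasDerivAt_pow 2 s).const_mul c).const_add 1
      simpa [mul_comm, mul_assoc, mul_left_comm] using h
    exact h.ofReal_comp
  have hinv : HasDerivAt (fun s : ℝ => (((((1 + c * s ^ 2 : ℝ)) : ℂ))⁻¹)) (-(((2 * c * s : ℝ) : ℂ)) / ((((1 + c * s ^ 2 : ℝ)) : ℂ)) ^ 2) s :=
    hq.fun_inv hq0
  induction n with
  | zero =>
    simp only [pow_zero, Nat.cast_zero, neg_zero, zero_mul]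
    exact hasDerivAt_const s 1
  | succ n ih =>
    have h : HasDerivAt (fun s : ℝ => (((((1 + c * s ^ 2 : ℝ)) : ℂ))⁻¹) ^ n * (((((1 + c * s ^ 2 : ℝ)) : ℂ))⁻¹))
        ((-(n : ℂ) * (((2 * c * s : ℝ) : ℂ)) * (((((1 + c * s ^ 2 : ℝ)) : ℂ))⁻¹) ^ (n + 1)) * (((((1 + c * s ^ 2 : ℝ)) : ℂ))⁻¹) +
          (((((1 + c * s ^ 2 : ℝ)) : ℂ))⁻¹) ^ n * (-(((2 * c * s : ℝ) : ℂ)) / ((((1 + c * s ^ 2 : ℝ)) : ℂ)) ^ 2)) s := ih.fun_mul hinv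
    have hfun : (fun s : ℝ => (((((1 + c * s ^ 2 : ℝ)) : ℂ))⁻¹) ^ (n + 1)) =
        fun s : ℝ => (((((1 + c * s ^ 2 : ℝ)) : ℂ))⁻¹) ^ n * (((((1 + c * s ^ 2 : ℝ)) : ℂ))⁻¹) := by
      funext t; rw [pow_succ]
    rw [hfun]
    convert h using 1
    rw [div_eq_mul_inv, ← inv_pow]
    push_cast
    ring

/-- **THE STRUCTURE OF THE DERIVATIVES.**  For `c ≥ 0`, `z ∈ ℂ` and every `n`: there is a polynomial `Pₙ ∈ ℂ[X]` of degree `≤ n` with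
`F⁽ⁿ⁾(s) = F(s) · Pₙ(s) · ((1 + cs²) : ℂ)⁻¹ ^ n` for all `s`, where `F(s) = exp(−z·log(1 + cs²))` (`P₀ = 1`, `Pₙ₊₁ = −2c(z + n)·X·Pₙ + (1 + cX²)·Pₙ'`).
[cite: HormanderALPDO1, §7.1] -/
theorem exists_polynomial_iteratedDeriv_eq {c : ℝ} (hc : 0 ≤ c) (z : ℂ) (n : ℕ) :
    ∃ P : ℂ[X], P.natDegree ≤ n ∧ ∀ s : ℝ,
      iteratedDeriv n (fun s : ℝ => Complex.exp (-z * (Real.log (1 + c * s ^ 2) : ℂ))) s =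
        Complex.exp (-z * (Real.log (1 + c * s ^ 2) : ℂ)) * P.eval (s : ℂ) * (((((1 + c * s ^ 2 : ℝ)) : ℂ))⁻¹) ^ n := by
  induction n with
  | zero => exact ⟨1, by simp, fun s => by simp⟩
  | succ n ih =>
    obtain ⟨P, hPdeg, hP⟩ := ih
    -- the next polynomial
    refine ⟨-(2 * (c : ℂ) * (z + n)) • (X * P) + (1 + C (c : ℂ) * X ^ 2) * P.derivative, ?_, fun s => ?_⟩
    · -- degree bound
      refine (Polynomial.natDegree_add_le _ _).trans (max_le ?_ ?_)
      · refine (Polynomial.natDegree_smul_le _ _).trans ?_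
        refine (Polynomial.natDegree_mul_le).trans ?_
        rw [Polynomial.natDegree_X]
        omega
      · by_cases hP0 : P.derivative = 0
        · rw [hP0, mul_zero, Polynomial.natDegree_zero]
          exact Nat.zero_le _
        · refine (Polynomial.natDegree_mul_le).trans ?_
          have h1 : (1 + C (c : ℂ) * X ^ 2 : ℂ[X]).natDegree ≤ 2 := by
            refine (Polynomial.natDegree_add_le _ _).trans (max_le (by simp) ?_)
            exact (Polynomial.natDegree_C_mul_le _ _).trans (by simp)
          have h2 : P.derivative.natDegree ≤ n - 1 := (Polynomial.natDegree_derivative_le P).trans (Nat.sub_le_sub_right hPdeg 1)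
          have h3 : 1 ≤ P.natDegree := Nat.one_le_iff_ne_zero.2 fun h0 => hP0 (Polynomial.derivative_of_natDegree_zero h0)
          omega
    · -- the derivative of `F · Pₙ · Q⁻¹^n`
      rw [iteratedDeriv_succ]
      have hfun : iteratedDeriv n (fun s : ℝ => Complex.exp (-z * (Real.log (1 + c * s ^ 2) : ℂ))) =
          fun s : ℝ => Complex.exp (-z * (Real.log (1 + c * s ^ 2) : ℂ)) * P.eval (s : ℂ) * (((((1 + c * s ^ 2 : ℝ)) : ℂ))⁻¹) ^ n :=
        funext hP
      rw [hfun]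
      have hq0 : ((((1 + c * s ^ 2 : ℝ)) : ℂ)) ≠ 0 := by exact_mod_cast (onePlusSq_pos hc s).ne'
      have hF := hasDerivAt_exp_neg_mul_log hc z s
      have hPd := hasDerivAt_polynomial_eval_ofReal P s
      have hQ := hasDerivAt_inv_onePlusSq_pow hc n s
      have h := (hF.fun_mul hPd).fun_mul hQ
      rw [h.deriv]
      simp only [Polynomial.eval_add, Polynomial.eval_smul, Polynomial.eval_mul, Polynomial.eval_X, Polynomial.eval_pow, Polynomial.eval_C,
        Polynomial.eval_one, smul_eq_mul]
      have hq0' : (1 + (c : ℂ) * (s : ℂ) ^ 2) ≠ 0 := by exact_mod_cast hq0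
      have key : (1 + (c : ℂ) * (s : ℂ) ^ 2) * (1 + (c : ℂ) * (s : ℂ) ^ 2)⁻¹ = 1 := mul_inv_cancel₀ hq0'
      push_cast
      linear_combination (-(Complex.exp (-z * ((Real.log (1 + c * s ^ 2) : ℝ) : ℂ)) * P.derivative.eval (s : ℂ) * (1 + (c : ℂ) * (s : ℂ) ^ 2)⁻¹ ^ n)) * key

/-! ## §3 The symbol estimate -/

/-- `|s|^i ≤ K^i · (1 + c s²)^i` with `K = max 1 c⁻¹` (`c > 0`): `|s| ≤ 1 + s² ≤ K(1 + cs²)`. [folklore] -/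
theorem abs_pow_le_mul_onePlusSq_pow {c : ℝ} (hc : 0 < c) (s : ℝ) (i : ℕ) :
    |s| ^ i ≤ (max 1 c⁻¹) ^ i * (1 + c * s ^ 2) ^ i := by
  rw [← mul_pow]
  refine pow_le_pow_left₀ (abs_nonneg s) ?_ i
  have h1 : |s| ≤ 1 + s ^ 2 := by
    rcases le_or_gt |s| 1 with h | h
    · exact h.trans (le_add_of_nonneg_right (sq_nonneg s))
    · calc |s| ≤ |s| * |s| := le_mul_of_one_le_right (abs_nonneg s) h.le
        _ = s ^ 2 := by rw [← sq, sq_abs]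
        _ ≤ 1 + s ^ 2 := le_add_of_nonneg_left zero_le_one
  have h2 : 1 + s ^ 2 ≤ max 1 c⁻¹ * (1 + c * s ^ 2) := by
    have hK1 : 1 ≤ max 1 c⁻¹ := le_max_left _ _
    have hKc : 1 ≤ max 1 c⁻¹ * c := by
      calc (1 : ℝ) = c⁻¹ * c := (inv_mul_cancel₀ hc.ne').symm
        _ ≤ max 1 c⁻¹ * c := mul_le_mul_of_nonneg_right (le_max_right _ _) hc.le
    calc 1 + s ^ 2 = 1 * 1 + 1 * s ^ 2 := by ring
      _ ≤ max 1 c⁻¹ * 1 + (max 1 c⁻¹ * c) * s ^ 2 :=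
          add_le_add (mul_le_mul_of_nonneg_right hK1 zero_le_one) (mul_le_mul_of_nonneg_right hKc (sq_nonneg s))
      _ = max 1 c⁻¹ * (1 + c * s ^ 2) := by ring
  exact h1.trans h2

/-- **A polynomial of degree `≤ n` against `(1 + cs²)^{−n}` is bounded**: `‖P(s)‖ · (1 + cs²)^{−n} ≤ Kⁿ · Σᵢ ‖aᵢ‖` (`K = max 1 c⁻¹`, `c > 0`). [folklore] -/
theorem norm_eval_mul_inv_pow_le {c : ℝ} (hc : 0 < c) {P : ℂ[X]} {n : ℕ} (hP : P.natDegree ≤ n) (s : ℝ) :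
    ‖P.eval (s : ℂ)‖ * ((1 + c * s ^ 2)⁻¹) ^ n ≤ (max 1 c⁻¹) ^ n * ∑ i ∈ Finset.range (n + 1), ‖P.coeff i‖ := by
  have hq1 : 1 ≤ 1 + c * s ^ 2 := one_le_onePlusSq hc.le s
  have hq0 : 0 < 1 + c * s ^ 2 := onePlusSq_pos hc.le s
  have hK1 : 1 ≤ max 1 c⁻¹ := le_max_left _ _
  rw [Polynomial.eval_eq_sum_range' (Nat.lt_succ_of_le hP), Finset.mul_sum]
  refine (mul_le_mul_of_nonneg_right (norm_sum_le _ _) (by positivity)).trans ?_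
  rw [Finset.sum_mul]
  refine Finset.sum_le_sum fun i hi => ?_
  have hin : i ≤ n := Nat.lt_succ_iff.1 (Finset.mem_range.1 hi)
  rw [norm_mul, norm_pow, Complex.norm_real, Real.norm_eq_abs]
  -- `‖aᵢ‖ |s|^i (1+cs²)^{-n} ≤ ‖aᵢ‖ K^i (1+cs²)^{i-n} ≤ K^n ‖aᵢ‖`
  have h1 : |s| ^ i * ((1 + c * s ^ 2)⁻¹) ^ n ≤ (max 1 c⁻¹) ^ n := by
    calc |s| ^ i * ((1 + c * s ^ 2)⁻¹) ^ n ≤ ((max 1 c⁻¹) ^ i * (1 + c * s ^ 2) ^ i) * ((1 + c * s ^ 2)⁻¹) ^ n :=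
          mul_le_mul_of_nonneg_right (abs_pow_le_mul_onePlusSq_pow hc s i) (by positivity)
      _ = (max 1 c⁻¹) ^ i * ((1 + c * s ^ 2) ^ i / (1 + c * s ^ 2) ^ n) := by rw [inv_pow, div_eq_mul_inv]; ring
      _ ≤ (max 1 c⁻¹) ^ i * 1 := by
          refine mul_le_mul_of_nonneg_left ?_ (by positivity)
          rw [div_le_one (by positivity)]
          exact pow_le_pow_right₀ hq1 hin
      _ ≤ (max 1 c⁻¹) ^ n := by rw [mul_one]; exact pow_le_pow_right₀ hK1 hin
  calc ‖P.coeff i‖ * |s| ^ i * ((1 + c * s ^ 2)⁻¹) ^ n = ‖P.coeff i‖ * (|s| ^ i * ((1 + c * s ^ 2)⁻¹) ^ n) := by ring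
    _ ≤ ‖P.coeff i‖ * (max 1 c⁻¹) ^ n := mul_le_mul_of_nonneg_left h1 (norm_nonneg _)
    _ = (max 1 c⁻¹) ^ n * ‖P.coeff i‖ := mul_comm _ _

/-- **THE SYMBOL ESTIMATE (exponential form).**  For `c > 0`, `z ∈ ℂ` and every `n` there is `C ≥ 0` with `‖F⁽ⁿ⁾(s)‖ ≤ C · (1 + c s²)^{−Re z}` for all `s ∈ ℝ`, `F(s) = exp(−z·log(1+cs²))`:
every derivative of `F` is dominated by `‖F‖` itself. [cite: HormanderALPDO1, §7.1] [cite: MoeglinWaldspurger1995, I.2.10–I.2.12] -/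
theorem exists_norm_iteratedDeriv_exp_neg_mul_log_le {c : ℝ} (hc : 0 < c) (z : ℂ) (n : ℕ) :
    ∃ C : ℝ, 0 ≤ C ∧ ∀ s : ℝ, ‖iteratedDeriv n (fun s : ℝ => Complex.exp (-z * (Real.log (1 + c * s ^ 2) : ℂ))) s‖ ≤ C * (1 + c * s ^ 2) ^ (-z.re) := by
  obtain ⟨P, hPdeg, hP⟩ := exists_polynomial_iteratedDeriv_eq hc.le z n
  refine ⟨(max 1 c⁻¹) ^ n * ∑ i ∈ Finset.range (n + 1), ‖P.coeff i‖, by positivity, fun s => ?_⟩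
  have hq0 : 0 < 1 + c * s ^ 2 := onePlusSq_pos hc.le s
  rw [hP s, norm_mul, norm_mul, norm_exp_neg_mul_log hc.le, norm_pow, norm_inv, Complex.norm_real, Real.norm_eq_abs, abs_of_pos hq0]
  calc (1 + c * s ^ 2) ^ (-z.re) * ‖P.eval (s : ℂ)‖ * ((1 + c * s ^ 2)⁻¹) ^ n
      = (‖P.eval (s : ℂ)‖ * ((1 + c * s ^ 2)⁻¹) ^ n) * (1 + c * s ^ 2) ^ (-z.re) := by ring
    _ ≤ ((max 1 c⁻¹) ^ n * ∑ i ∈ Finset.range (n + 1), ‖P.coeff i‖) * (1 + c * s ^ 2) ^ (-z.re) :=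
        mul_le_mul_of_nonneg_right (norm_eval_mul_inv_pow_le hc hPdeg s) (Real.rpow_nonneg hq0.le _)

/-- **THE SYMBOL ESTIMATE FOR `(1 + c s²)^{−z}`**: for `c > 0`, `z ∈ ℂ`, every `n`: `∃ C ≥ 0, ∀ s, ‖Dⁿ[s ↦ ((1 + c s²) : ℂ)^{−z}](s)‖ ≤ C · (1 + c s²)^{−Re z}` — the one-variable
input of the archimedean smoothness of the spherical flat section of `U(1,1)` along the big-cell line (tensor product over the infinite places of the totally real base field).
[cite: HormanderALPDO1, §7.1] [cite: MoeglinWaldspurger1995, I.2.10–I.2.12] [cite: Garrett2018, §12.2] -/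
theorem exists_norm_iteratedDeriv_le {c : ℝ} (hc : 0 < c) (z : ℂ) (n : ℕ) :
    ∃ C : ℝ, 0 ≤ C ∧ ∀ s : ℝ, ‖iteratedDeriv n (fun s : ℝ => ((((1 + c * s ^ 2 : ℝ)) : ℂ) ^ (-z))) s‖ ≤ C * (1 + c * s ^ 2) ^ (-z.re) := by
  have hfun : (fun s : ℝ => ((((1 + c * s ^ 2 : ℝ)) : ℂ) ^ (-z))) = fun s : ℝ => Complex.exp (-z * (Real.log (1 + c * s ^ 2) : ℂ)) :=
    funext fun s => (exp_neg_mul_log_eq_cpow hc.le z s).symm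
  rw [hfun]
  exact exists_norm_iteratedDeriv_exp_neg_mul_log_le hc z n

/-- **The same for Fréchet derivatives** (`‖iteratedFDeriv ℝ n‖ = ‖iteratedDeriv n‖` in one variable) and with the modulus identified: `‖Dⁿ F(s)‖ ≤ C · ‖F(s)‖`.
[cite: HormanderALPDO1, §7.1] -/
theorem exists_norm_iteratedFDeriv_le {c : ℝ} (hc : 0 < c) (z : ℂ) (n : ℕ) :
    ∃ C : ℝ, 0 ≤ C ∧ ∀ s : ℝ, ‖iteratedFDeriv ℝ n (fun s : ℝ => ((((1 + c * s ^ 2 : ℝ)) : ℂ) ^ (-z))) s‖ ≤ C * (1 + c * s ^ 2) ^ (-z.re) := by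
  obtain ⟨C, hC, h⟩ := exists_norm_iteratedDeriv_le hc z n
  exact ⟨C, hC, fun s => by rw [norm_iteratedFDeriv_eq_norm_iteratedDeriv]; exact h s⟩

/-- The modulus of the principal power: `‖((1 + cs²) : ℂ)^{−z}‖ = (1 + cs²)^{−Re z}`. [folklore] -/
theorem norm_onePlusSqPow {c : ℝ} (hc : 0 ≤ c) (z : ℂ) (s : ℝ) :
    ‖((((1 + c * s ^ 2 : ℝ)) : ℂ) ^ (-z))‖ = (1 + c * s ^ 2) ^ (-z.re) := by
  rw [← exp_neg_mul_log_eq_cpow hc z s, norm_exp_neg_mul_log hc z s]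

end Summit.HodgeConjecture.HodgeConjecture.Cruxes.H413.K2E1OnePlusSqPowerSymbol

end
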